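import Mathlib.Analysis.SpecialFunctions.Log.Basic
import HarnessLib

/-!
# ζ(5) search — class `elim`: the PAIR ENVELOPE for two-family elimination of ζ(3) (cell `pub-zeta5`, fam-elim)

HONEST FRAMING: systematic search; no irrationality claim unless certified.

OUR work (Summit side; families/elim/FAMILY.md §5, Proposition P1). Two three-term families
`r^F_n = u^F_n ζ(5) + w^F_n ζ(3) - v^F_n`, `r^G_n = …` are combined into the ζ(3)-free ELIMINANT
`ℓ_n = w^G_n r^F_n - w^F_n r^G_n`. This file proves the elementary real-analysis envelope that prices
every such pair from the partners' rates (`RateLE` = exponential upper rate, `RateGE` = lower rate,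
both in the `∀ ε > 0, eventually` form used by the cell's certificates):

* `eliminant_rateLE` — `|ℓ_n| ≤ e^{(max(β_G + ρ_F, β_F + ρ_G) + ε) n}` eventually (triangle inequality);
* `eliminant_rateGE` — if the two products have DIFFERENT rates (`β_F + ρ_G < β_G + ρ_F`) and the dominant
  product's factors have exact rates, then `|ℓ_n| ≥ e^{(β_G + ρ_F - ε) n}` eventually: NO cancellation is
  possible between unrelated families (`| |a| - |b| | ≤ |a - b|`);
* `margin_le_mean`, `mean_le_max` — the bookkeeping corollary in CRITERIA units: with product-rule
  denominators the C1-margin of a cross eliminant is at most the MEAN of the partners' Fischler–Zudilin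
  exponents `c - b - δ_v - δ_w` (hence at most the better one), FAMILY.md P1(d);
* `rateLE_of_tendsto_log_div`, `rateGE_of_tendsto_log_div` — bridges from the tree's `log|x_n|/n → a` style.

Here `ρ_X = -c_X` is the (negative) rate of the small forms and `β_X = b_X` the growth of the ζ(3)-coefficients.
Nothing about ζ-values, denominators or any specific family is used: pure bookkeeping, 0 sorry.
-/

noncomputable section

open Filter Topology

namespace Summit.KontsevichZagierPeriods.Zeta5Search

namespace Elimination

/-- Exponential UPPER rate: `|x n| ≤ e^{(a+ε) n}` for all large `n`, for every `ε > 0` (a predicate, not a statement). [folklore] -/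
@[folklore] def RateLE (x : ℕ → ℝ) (a : ℝ) : Prop :=
  ∀ ε : ℝ, 0 < ε → ∀ᶠ n : ℕ in atTop, |x n| ≤ Real.exp ((a + ε) * n)

/-- Exponential LOWER rate: `e^{(a-ε) n} ≤ |x n|` for all large `n`, for every `ε > 0` (a predicate, not a statement). [folklore] -/
@[folklore] def RateGE (x : ℕ → ℝ) (a : ℝ) : Prop :=
  ∀ ε : ℝ, 0 < ε → ∀ᶠ n : ℕ in atTop, Real.exp ((a - ε) * n) ≤ |x n|

/-- `e^{κ n} ≥ 2` eventually, for `κ > 0`. -/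
theorem eventually_two_le_exp {κ : ℝ} (hκ : 0 < κ) :
    ∀ᶠ n : ℕ in atTop, (2 : ℝ) ≤ Real.exp (κ * n) := by
  have h : Tendsto (fun n : ℕ => Real.exp (κ * n)) atTop atTop :=
    Real.tendsto_exp_atTop.comp (tendsto_natCast_atTop_atTop.const_mul_atTop hκ)
  exact h.eventually_ge_atTop 2

/-- Monotonicity in the exponent: a larger upper exponent is still an upper exponent. -/
theorem RateLE.mono {x : ℕ → ℝ} {a a' : ℝ} (h : RateLE x a) (haa' : a ≤ a') : RateLE x a' := by
  intro ε hε
  filter_upwards [h ε hε] with n hn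
  refine hn.trans ?_
  rw [Real.exp_le_exp]
  have : (0 : ℝ) ≤ n := Nat.cast_nonneg n
  nlinarith

/-- Product rule for upper rates. -/
theorem rateLE_mul {x y : ℕ → ℝ} {a b : ℝ} (hx : RateLE x a) (hy : RateLE y b) :
    RateLE (fun n => x n * y n) (a + b) := by
  intro ε hε
  filter_upwards [hx (ε / 2) (by linarith), hy (ε / 2) (by linarith)] with n hxn hyn
  rw [abs_mul]
  calc |x n| * |y n| ≤ Real.exp ((a + ε / 2) * n) * Real.exp ((b + ε / 2) * n) :=
        mul_le_mul hxn hyn (abs_nonneg _) (Real.exp_pos _).le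
    _ = Real.exp ((a + b + ε) * n) := by rw [← Real.exp_add]; ring_nf

/-- Product rule for lower rates. -/
theorem rateGE_mul {x y : ℕ → ℝ} {a b : ℝ} (hx : RateGE x a) (hy : RateGE y b) :
    RateGE (fun n => x n * y n) (a + b) := by
  intro ε hε
  filter_upwards [hx (ε / 2) (by linarith), hy (ε / 2) (by linarith)] with n hxn hyn
  rw [abs_mul]
  calc Real.exp ((a + b - ε) * n) = Real.exp ((a - ε / 2) * n) * Real.exp ((b - ε / 2) * n) := by
        rw [← Real.exp_add]; ring_nf
    _ ≤ |x n| * |y n| := mul_le_mul hxn hyn (Real.exp_pos _).le (abs_nonneg _)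

/-- Difference (sum) rule for upper rates: the rate of a difference is at most the larger rate. -/
theorem rateLE_sub {x y : ℕ → ℝ} {a b : ℝ} (hx : RateLE x a) (hy : RateLE y b) :
    RateLE (fun n => x n - y n) (max a b) := by
  intro ε hε
  have hx' := (hx.mono (le_max_left a b)) (ε / 2) (by linarith)
  have hy' := (hy.mono (le_max_right a b)) (ε / 2) (by linarith)
  filter_upwards [hx', hy', eventually_two_le_exp (show 0 < ε / 2 by linarith)] with n hxn hyn h2
  have hE : (0 : ℝ) < Real.exp ((max a b + ε / 2) * n) := Real.exp_pos _
  calc |x n - y n| ≤ |x n| + |y n| := abs_sub _ _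
    _ ≤ 2 * Real.exp ((max a b + ε / 2) * n) := by linarith
    _ ≤ Real.exp (ε / 2 * n) * Real.exp ((max a b + ε / 2) * n) :=
        mul_le_mul_of_nonneg_right h2 hE.le
    _ = Real.exp ((max a b + ε) * n) := by rw [← Real.exp_add]; ring_nf

/-- NO CANCELLATION under a rate gap: if `x` has exact lower rate `a` and `y` has upper rate `b < a`,
then `x - y` still has lower rate `a`. -/
theorem rateGE_sub_of_gap {x y : ℕ → ℝ} {a b : ℝ} (hx : RateGE x a) (hy : RateLE y b) (hab : b < a) :
    RateGE (fun n => x n - y n) a := by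
  intro ε hε
  -- shrink ε to ε₁ = min ε ((a-b)/2)
  set ε₁ : ℝ := min ε ((a - b) / 2) with hε₁
  have hε₁pos : 0 < ε₁ := lt_min hε (by linarith)
  have hε₁le : ε₁ ≤ ε := min_le_left _ _
  have hε₁gap : ε₁ ≤ (a - b) / 2 := min_le_right _ _
  filter_upwards [hx (ε₁ / 2) (by linarith), hy ((a - b) / 2) (by linarith),
    eventually_two_le_exp (show 0 < ε₁ / 2 by linarith)] with n hxn hyn h2
  have hn : (0 : ℝ) ≤ n := Nat.cast_nonneg n
  set E : ℝ := Real.exp ((a - ε₁) * n) with hEdef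
  have hEpos : 0 < E := Real.exp_pos _
  -- |x n| ≥ e^{(ε₁/2) n} E ≥ 2E
  have hx2 : 2 * E ≤ |x n| := by
    have hsplit : Real.exp ((a - ε₁ / 2) * n) = Real.exp (ε₁ / 2 * n) * E := by
      rw [hEdef, ← Real.exp_add]; ring_nf
    rw [hsplit] at hxn
    exact le_trans (mul_le_mul_of_nonneg_right h2 hEpos.le) hxn
  -- |y n| ≤ e^{(b + (a-b)/2) n} ≤ E
  have hyE : |y n| ≤ E := by
    refine hyn.trans ?_
    rw [hEdef, Real.exp_le_exp]
    nlinarith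
  -- e^{(a-ε) n} ≤ E
  have hεE : Real.exp ((a - ε) * n) ≤ E := by
    rw [hEdef, Real.exp_le_exp]; nlinarith
  have habs : |x n| - |y n| ≤ |x n - y n| := abs_sub_abs_le_abs_sub _ _
  linarith

/-- **P1(a): the pair envelope, upper half.** For any two families, the eliminant
`w^G r^F - w^F r^G` decays no faster than... i.e. is BOUNDED ABOVE by the larger of the two products:
upper rate `max (β_G + ρ_F) (β_F + ρ_G)`. -/
theorem eliminant_rateLE {rF wF rG wG : ℕ → ℝ} {ρF βF ρG βG : ℝ}
    (hrF : RateLE rF ρF) (hwF : RateLE wF βF) (hrG : RateLE rG ρG) (hwG : RateLE wG βG) :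
    RateLE (fun n => wG n * rF n - wF n * rG n) (max (βG + ρF) (βF + ρG)) :=
  rateLE_sub (rateLE_mul hwG hrF) (rateLE_mul hwF hrG)

/-- **P1(b): the pair envelope, lower half (no cancellation).** If the dominant product `w^G r^F` has
exact rate `β_G + ρ_F` (lower rates for both factors) and the other product is exponentially smaller
(`β_F + ρ_G < β_G + ρ_F`), the eliminant has lower rate `β_G + ρ_F`: its decay exponent is EXACTLY
`min(c_F - b_G, c_G - b_F)` and no choice of partner produces cancellation. -/
theorem eliminant_rateGE {rF wF rG wG : ℕ → ℝ} {ρF βF ρG βG : ℝ}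
    (hrF : RateGE rF ρF) (hwG : RateGE wG βG) (hwF : RateLE wF βF) (hrG : RateLE rG ρG)
    (hgap : βF + ρG < βG + ρF) :
    RateGE (fun n => wG n * rF n - wF n * rG n) (βG + ρF) :=
  rateGE_sub_of_gap (rateGE_mul hwG hrF) (rateLE_mul hwF hrG) hgap

/-- **P1(a)+(b) packaged:** under the gap hypothesis the eliminant's rate is exactly `β_G + ρ_F`
(upper and lower). -/
theorem eliminant_rate_exact {rF wF rG wG : ℕ → ℝ} {ρF βF ρG βG : ℝ}
    (hrF : RateLE rF ρF) (hrF' : RateGE rF ρF) (hwF : RateLE wF βF)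
    (hrG : RateLE rG ρG) (hwG : RateLE wG βG) (hwG' : RateGE wG βG)
    (hgap : βF + ρG < βG + ρF) :
    RateLE (fun n => wG n * rF n - wF n * rG n) (βG + ρF) ∧
      RateGE (fun n => wG n * rF n - wF n * rG n) (βG + ρF) := by
  refine ⟨?_, eliminant_rateGE hrF' hwG' hwF hrG hgap⟩
  have h := eliminant_rateLE hrF hwF hrG hwG
  rwa [max_eq_left hgap.le] at h

/-- **P1(d), arithmetic half: min-rule decay minus product-rule denominators ≤ the MEAN of the two
Fischler–Zudilin exponents.** (`cX` decay, `bX` growth, `δvX, δwX` denominator rates of the constant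
and ζ(3) coefficients of family `X`.) -/
theorem margin_le_mean (cF bF δvF δwF cG bG δvG δwG : ℝ) :
    min (cF - bG) (cG - bF) - max (δwG + δvF) (δwF + δvG)
      ≤ ((cF - bF - δvF - δwF) + (cG - bG - δvG - δwG)) / 2 := by
  have h1 := min_le_left (cF - bG) (cG - bF)
  have h2 := min_le_right (cF - bG) (cG - bF)
  have h3 := le_max_left (δwG + δvF) (δwF + δvG)
  have h4 := le_max_right (δwG + δvF) (δwF + δvG)
  linarith

/-- … and the mean is at most the better partner. -/
theorem mean_le_max (x y : ℝ) : (x + y) / 2 ≤ max x y := by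
  have h1 := le_max_left x y
  have h2 := le_max_right x y
  linarith

/-- Bridge from the tree's log-rate style: `log|x n|/n → a` gives the upper rate `a`. -/
theorem rateLE_of_tendsto_log_div {x : ℕ → ℝ} {a : ℝ}
    (h : Tendsto (fun n : ℕ => Real.log |x n| / n) atTop (𝓝 a)) : RateLE x a := by
  intro ε hε
  filter_upwards [h.eventually_lt_const (show a < a + ε by linarith), eventually_ge_atTop 1] with n hn hn1
  have hnpos : (0 : ℝ) < n := by exact_mod_cast hn1
  have hlog : Real.log |x n| < (a + ε) * n := by rwa [div_lt_iff₀ hnpos] at hn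
  by_cases hx : x n = 0
  · rw [hx, abs_zero]; exact (Real.exp_pos _).le
  · rw [← Real.exp_log (abs_pos.mpr hx), Real.exp_le_exp]
    exact hlog.le

/-- Bridge, lower half: `log|x n|/n → a` with `x n ≠ 0` eventually gives the lower rate `a`. -/
theorem rateGE_of_tendsto_log_div {x : ℕ → ℝ} {a : ℝ}
    (h : Tendsto (fun n : ℕ => Real.log |x n| / n) atTop (𝓝 a))
    (hne : ∀ᶠ n : ℕ in atTop, x n ≠ 0) : RateGE x a := by
  intro ε hε
  filter_upwards [h.eventually_const_lt (show a - ε < a by linarith), eventually_ge_atTop 1, hne]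
    with n hn hn1 hx
  have hnpos : (0 : ℝ) < n := by exact_mod_cast hn1
  have hlog : (a - ε) * n < Real.log |x n| := by rwa [lt_div_iff₀ hnpos] at hn
  rw [← Real.exp_log (abs_pos.mpr hx), Real.exp_le_exp]
  exact hlog.le

end Elimination

end Summit.KontsevichZagierPeriods.Zeta5Search
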